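import Literature.Combinatorics.SimpleGraph.LovaszThetaPenalty
import Mathlib.Analysis.LocallyConvex.Separation
import Mathlib.Topology.Instances.Matrix
import Mathlib.LinearAlgebra.Pi
import HarnessLib

/-!
# The eigenvalue (dual) characterisation of the Lovász number: `ϑ(H) = min Λ(A)`

Lovász's theta number of a finite graph `H` is defined in the tree in its semidefinite
MAXIMISATION form `ϑ(H) = sup {𝟙ᵀB𝟙 : B ⪰ 0, Tr B = 1, B_{uv} = 0 (uv ∈ E(H))}`
(`Literature.Combinatorics.SimpleGraph.lovaszTheta`, Knuth's `ϑ₃`, Knuth 1994 §7 (7.1) with unit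
weights). This file proves the companion MINIMISATION form over the *feasible matrices*
(Knuth 1994, §6 (6.1), unit weights; Lovász 1979, Theorem 3): real symmetric `A` with `A_{vv} = 1`
and `A_{uv} = 1` whenever `u, v` are NOT adjacent, the other entries free,

  `ϑ(H) = inf { s : some feasible A has all eigenvalues ≤ s } = min_A Λ(A)`,

in the form the tree's approximation algorithm for `ϑ` consumes
(`Literature/Computability/Complexity/ThetaApproximation.lean`): "all eigenvalues `≤ s`" is written
`(s • 1 - A).PosSemidef`, so no eigenvalue API is needed to USE the results.

* `IsThetaDualFeasible H A` — Knuth's feasible matrices for unit weights;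
* `one_le_lovaszTheta` — `1 ≤ ϑ(H)` on a nonempty vertex set (`|V|⁻¹ I` is feasible);
* `trace_mul_nonneg_of_posSemidef` — `0 ≤ Tr(X B)` for real `X, B ⪰ 0` (spectral decomposition of
  `B`); WEAK DUALITY `entrySum_le_of_dual`: `𝟙ᵀB𝟙 ≤ s` for theta-feasible `B` and dual-feasible `A`
  with `sI - A ⪰ 0` (`𝟙ᵀB𝟙 = Tr(AB)` because `A = J` off the edges and `B = 0` on them, and
  `Tr((sI - A)B) ≥ 0`), hence `lovaszTheta_le_of_dual` (Knuth 1994, the chain `ϑ₃ ≤ … ≤ ϑ₂`);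
* STRONG DUALITY `exists_dual_of_lovaszTheta_lt` (Knuth 1994, §7 Lemma `ϑ₂ ≤ ϑ₃`, "the heart of
  the proof", via the separation Fact of §§8–9): for every `s > ϑ(H)` there is a dual-feasible `A`
  with `sI - A ⪰ 0`. Proof: the compact convex set `{(𝟙ᵀB𝟙, B|_E) : B ⪰ 0, Tr B = 1}` misses the
  point `(s, 0)` (the set is the image of the spectraplex `IsSpectraplex` of
  `LovaszThetaPenalty.lean`, compact by `isCompact_setOf_isSpectraplex`); a separating functional
  (Mathlib's geometric Hahn–Banach) is a symmetric matrix
  `N = t₀ J + Ψ`, `Ψ` supported on `E`, with `⟨N, B⟩ < t₀ s` on that set; testing `B = |V|⁻¹ I`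
  gives `t₀ > 0`, and `A = N / t₀` is feasible with `xᵀAx < s‖x‖²`;
* `lovaszTheta_eq_sInf_dual` — the equality `ϑ(H) = inf {s | ∃ feasible A, sI - A ⪰ 0}`;
* `exists_dual_of_lovaszTheta_eq`, `isLeast_lovaszTheta_dual`, `lovaszTheta_eq_min_topEigenvalue` —
  the infimum is ATTAINED (compactness of near-optimal dual solutions), i.e. Lovász's
  `ϑ(H) = min_A Λ(A)` with `Λ = topEigenvalue` as printed;
* `abs_apply_le_of_dual` — a feasible `A` with `sI - A ⪰ 0` has `|A_{uv}| ≤ s - 1` off the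
  diagonal (the a-priori bound on near-optimal dual solutions used by the algorithm).

Not here: the weighted versions `ϑ(G, w)`, and Knuth's `ϑ₁, ϑ₄` (orthogonal labelings).

## References

* D. E. Knuth, *The Sandwich Theorem*, Electron. J. Combin. 1 (1994), A1, §6 ((6.1)–(6.3):
  feasible matrices, `ϑ₂ = min Λ(A)`), §7 (Lemma `ϑ₂ ≤ ϑ₃`), §§8–9 (the separation Fact)
  [Knuth1994] (held: `lit read arxiv:math/9312214`).
* L. Lovász, *On the Shannon capacity of a graph*, IEEE Trans. Inform. Theory 25 (1979) 1–7,
  Theorems 3–5 [Lovasz1979].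
-/

noncomputable section

namespace Literature.Combinatorics.SimpleGraph

open Matrix Finset Literature.LinearAlgebra.Matrix

variable {V : Type*}

/-! ### Dual feasible matrices -/

/-- **Knuth's feasible matrices** for the graph `H` with unit weights (Knuth 1994, (6.1); Lovász
1979, Theorem 3): real symmetric `A` with `A_{uv} = 1` whenever `u` and `v` are equal or
non-adjacent; the entries on the edges of `H` are free. [cite: Knuth1994, §6 (6.1)] -/
structure IsThetaDualFeasible (H : SimpleGraph V) (A : Matrix V V ℝ) : Prop where
  /-- `A` is symmetric -/
  isHermitian : A.IsHermitian
  /-- `A_{uv} = 1` off the edges (in particular on the diagonal) -/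
  apply_eq_one : ∀ ⦃u v : V⦄, ¬H.Adj u v → A u v = 1

/-- The all-ones matrix `J` is dual feasible for every graph. [folklore] -/
theorem isThetaDualFeasible_ones (H : SimpleGraph V) :
    IsThetaDualFeasible H (Matrix.of fun _ _ => (1 : ℝ)) where
  isHermitian := by
    rw [Matrix.IsHermitian, conjTranspose_eq_transpose_of_trivial]
    ext u v; rfl
  apply_eq_one _ _ _ := rfl

/-- A dual feasible matrix has unit diagonal. [cite: Knuth1994, §6 (6.1)] -/
theorem IsThetaDualFeasible.apply_self {H : SimpleGraph V} {A : Matrix V V ℝ}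
    (hA : IsThetaDualFeasible H A) (v : V) : A v v = 1 :=
  hA.apply_eq_one (H.irrefl (v := v))

/-- A dual feasible matrix is symmetric as a function: `Aᵀ = A`. [folklore] -/
theorem IsThetaDualFeasible.transpose_eq {H : SimpleGraph V} {A : Matrix V V ℝ}
    (hA : IsThetaDualFeasible H A) : Aᵀ = A := by
  have h := hA.isHermitian
  rwa [Matrix.IsHermitian, conjTranspose_eq_transpose_of_trivial] at h

/-- A dual feasible matrix is symmetric: `A u v = A v u`. [folklore] -/
theorem IsThetaDualFeasible.apply_comm {H : SimpleGraph V} {A : Matrix V V ℝ}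
    (hA : IsThetaDualFeasible H A) (u v : V) : A u v = A v u := by
  have h := congrFun (congrFun hA.transpose_eq v) u
  rw [transpose_apply] at h
  exact h

variable [Fintype V] [DecidableEq V]

/-! ### `1 ≤ ϑ(H)` -/

/-- The value of the feasible matrix `|V|⁻¹ I` is `1`. [folklore] -/
theorem entrySum_smul_one [Nonempty V] :
    entrySum ((Fintype.card V : ℝ)⁻¹ • (1 : Matrix V V ℝ)) = 1 := by
  have hn : (Fintype.card V : ℝ) ≠ 0 := by exact_mod_cast Fintype.card_ne_zero
  simp only [entrySum, Matrix.smul_apply, smul_eq_mul, ← mul_sum]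
  have h : ∑ u : V, ∑ v : V, (1 : Matrix V V ℝ) u v = Fintype.card V := by
    simp [Matrix.one_apply, Finset.sum_ite_eq]
  rw [h, inv_mul_cancel₀ hn]

/-- **`1 ≤ ϑ(H)`** for a graph on a nonempty vertex set (`|V|⁻¹ I` is feasible with value `1`;
Knuth 1994, §4: `ϑ ≥ α ≥ 1`). [folklore] -/
theorem one_le_lovaszTheta [Nonempty V] (H : SimpleGraph V) : 1 ≤ lovaszTheta H := by
  rw [← entrySum_smul_one (V := V)]
  exact le_csSup (bddAbove_thetaValues H) ⟨_, isThetaFeasible_smul_one H, rfl⟩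

/-! ### Weak duality -/

/-- **`0 ≤ Tr(X B)` for real positive semidefinite `X, B`**: in the spectral decomposition
`B = ∑ μᵢ uᵢuᵢᵀ` one has `Tr(XB) = ∑ μᵢ uᵢᵀXuᵢ` with `μᵢ ≥ 0` and `uᵢᵀXuᵢ ≥ 0`. [folklore] -/
theorem trace_mul_nonneg_of_posSemidef {X B : Matrix V V ℝ} (hX : X.PosSemidef) (hB : B.PosSemidef) :
    0 ≤ (X * B).trace := by
  have h := trace_mul_pow_eq_sum hB.1 X 1
  rw [pow_one] at h
  rw [h]
  refine sum_nonneg fun i _ => mul_nonneg ?_ ?_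
  · rw [star_eigU_mul_mul_eigU_apply hB.1 X i]
    have := hX.dotProduct_mulVec_nonneg (hB.1.eigenvectorBasis i).ofLp
    rwa [star_trivial] at this
  · rw [pow_one]; exact hB.eigenvalues_nonneg i

omit [DecidableEq V] in
/-- `Tr(A B) = ∑_{u,v} A_{uv} B_{uv}` for symmetric `B`. [folklore] -/
theorem trace_mul_eq_sum_of_transpose {A B : Matrix V V ℝ} (hB : Bᵀ = B) :
    (A * B).trace = ∑ u, ∑ v, A u v * B u v := by
  simp only [Matrix.trace, Matrix.diag, Matrix.mul_apply]
  refine sum_congr rfl fun u _ => sum_congr rfl fun v _ => ?_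
  rw [← hB, transpose_apply, hB]

omit [DecidableEq V] in
/-- For theta-feasible `B` and dual-feasible `A`, `∑_{u,v} A_{uv} B_{uv} = 𝟙ᵀB𝟙`: on an edge
`B_{uv} = 0`, elsewhere `A_{uv} = 1`. [cite: Knuth1994, §7 (proof of the Lemma)] -/
theorem sum_mul_eq_entrySum {H : SimpleGraph V} {A B : Matrix V V ℝ} (hA : IsThetaDualFeasible H A)
    (hB : IsThetaFeasible H B) : ∑ u, ∑ v, A u v * B u v = entrySum B := by
  refine sum_congr rfl fun u _ => sum_congr rfl fun v _ => ?_
  by_cases huv : H.Adj u v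
  · rw [hB.apply_eq_zero huv, mul_zero]
  · rw [hA.apply_eq_one huv, one_mul]

/-- **Weak duality** (Knuth 1994, the inequalities `ϑ₃ ≤ ϑ₄ ≤ ϑ ≤ ϑ₁ ≤ ϑ₂` of §§5–7, here in one
step): if `B` is theta-feasible, `A` is dual feasible and `sI - A ⪰ 0`, then `𝟙ᵀB𝟙 ≤ s`
(`𝟙ᵀB𝟙 = Tr(AB)` and `0 ≤ Tr((sI - A)B) = s - Tr(AB)`). [cite: Knuth1994, §§6–7] -/
theorem entrySum_le_of_dual {H : SimpleGraph V} {A B : Matrix V V ℝ} {s : ℝ}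
    (hB : IsThetaFeasible H B) (hA : IsThetaDualFeasible H A)
    (hs : (s • (1 : Matrix V V ℝ) - A).PosSemidef) : entrySum B ≤ s := by
  have hBt : Bᵀ = B := by
    have h := hB.posSemidef.1
    rwa [Matrix.IsHermitian, conjTranspose_eq_transpose_of_trivial] at h
  have h0 := trace_mul_nonneg_of_posSemidef hs hB.posSemidef
  rw [Matrix.sub_mul, trace_sub, Matrix.smul_mul, Matrix.one_mul, trace_smul, hB.trace_eq_one,
    smul_eq_mul, mul_one, trace_mul_eq_sum_of_transpose hBt, sum_mul_eq_entrySum hA hB] at h0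
  linarith

/-- **`ϑ(H) ≤ s`** whenever some dual feasible `A` has `sI - A ⪰ 0` (i.e. `Λ(A) ≤ s`):
`ϑ ≤ ϑ₂ = min Λ(A)` (Knuth 1994, §§5–6). [cite: Knuth1994, §6 (6.3)] -/
theorem lovaszTheta_le_of_dual {H : SimpleGraph V} {A : Matrix V V ℝ} {s : ℝ}
    (hA : IsThetaDualFeasible H A) (hs : (s • (1 : Matrix V V ℝ) - A).PosSemidef) (hs0 : 0 ≤ s) :
    lovaszTheta H ≤ s := by
  refine Real.sSup_le ?_ hs0
  rintro _ ⟨B, hB, rfl⟩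
  exact entrySum_le_of_dual hB hA hs

/-! ### Entry bounds for dual feasible matrices -/

/-- Off-diagonal entries of a real positive semidefinite matrix: `-B_{uv} ≤ (B_{uu} + B_{vv})/2`,
the companion of `two_mul_apply_le` (inlined in `IsSpectraplex.abs_apply_le_one`; stated here
because `abs_apply_le_of_dual` reuses it). [folklore] -/
theorem neg_two_mul_apply_le {B : Matrix V V ℝ} (hB : B.PosSemidef) (u v : V) :
    -(2 * B u v) ≤ B u u + B v v := by
  have h := two_mul_dotProduct_mulVec_le hB (Pi.single u 1) (-Pi.single v 1)
  simp only [mulVec_neg, dotProduct_neg, neg_dotProduct, neg_neg] at h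
  simpa [dotProduct_mulVec, single_one_vecMul, dotProduct_single] using h

omit [Fintype V] in
/-- A dual feasible `A` with `sI - A ⪰ 0` on a nonempty vertex set has `1 ≤ s` (look at a diagonal
entry). [folklore] -/
theorem one_le_of_dual [Nonempty V] {H : SimpleGraph V} {A : Matrix V V ℝ} {s : ℝ}
    (hA : IsThetaDualFeasible H A) (hs : (s • (1 : Matrix V V ℝ) - A).PosSemidef) : 1 ≤ s := by
  obtain ⟨v⟩ := ‹Nonempty V›
  have h := hs.diag_nonneg (i := v)
  simp only [Matrix.sub_apply, Matrix.smul_apply, Matrix.one_apply_eq, smul_eq_mul, mul_one,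
    hA.apply_self v] at h
  linarith

/-- **A-priori bound on near-optimal dual solutions**: a dual feasible `A` with `sI - A ⪰ 0` has
`|A_{uv}| ≤ s - 1` for `u ≠ v` (apply `2|X_{uv}| ≤ X_{uu} + X_{vv}` to `X = sI - A`, whose
diagonal is `s - 1`). [folklore] -/
theorem abs_apply_le_of_dual {H : SimpleGraph V} {A : Matrix V V ℝ} {s : ℝ}
    (hA : IsThetaDualFeasible H A) (hs : (s • (1 : Matrix V V ℝ) - A).PosSemidef) {u v : V}
    (huv : u ≠ v) : |A u v| ≤ s - 1 := by
  have h1 := two_mul_apply_le hs u v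
  have h2 := neg_two_mul_apply_le hs u v
  simp only [Matrix.sub_apply, Matrix.smul_apply, Matrix.one_apply_eq, Matrix.one_apply_ne huv,
    smul_eq_mul, mul_one, mul_zero, zero_sub, hA.apply_self] at h1 h2
  rw [abs_le]
  constructor <;> linarith

/-! ### Strong duality: the separation argument -/

omit [DecidableEq V] in
/-- The quadratic form as a double sum: `xᵀNx = ∑_{u,v} N_{uv} x_u x_v`. [folklore] -/
theorem dotProduct_mulVec_eq_sum_mul (N : Matrix V V ℝ) (x : V → ℝ) :
    x ⬝ᵥ (N *ᵥ x) = ∑ u, ∑ v, N u v * (x u * x v) := by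
  simp only [dotProduct, mulVec, Finset.mul_sum]
  exact sum_congr rfl fun u _ => sum_congr rfl fun v _ => by ring

/-- **The spectraplex `{B ⪰ 0, Tr B = 1}` is compact** (closed, and inside the box `|B_{uv}| ≤ 1`
by `IsSpectraplex.abs_apply_le_one`). [folklore] -/
theorem isCompact_setOf_isSpectraplex : IsCompact {B : Matrix V V ℝ | IsSpectraplex B} := by
  -- the box
  have hbox : IsCompact (Set.pi Set.univ fun _ : V => Set.pi Set.univ fun _ : V => Set.Icc (-1 : ℝ) 1) :=
    isCompact_univ_pi fun _ => isCompact_univ_pi fun _ => isCompact_Icc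
  refine hbox.of_isClosed_subset ?_ ?_
  · have hset : {B : Matrix V V ℝ | IsSpectraplex B} =
        ({B : Matrix V V ℝ | Bᴴ = B} ∩ ⋂ x : V → ℝ, {B : Matrix V V ℝ | 0 ≤ x ⬝ᵥ (B *ᵥ x)}) ∩
          {B : Matrix V V ℝ | B.trace = 1} := by
      ext B
      simp only [Set.mem_setOf_eq, Set.mem_inter_iff, Set.mem_iInter]
      rw [show IsSpectraplex B ↔ B.PosSemidef ∧ B.trace = 1 from ⟨fun h => ⟨h.1, h.2⟩, fun h => ⟨h.1, h.2⟩⟩,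
        posSemidef_iff_dotProduct_mulVec]
      simp only [star_trivial]
      rfl
    rw [hset]
    refine IsClosed.inter (IsClosed.inter (isClosed_eq continuous_id.matrix_conjTranspose continuous_id)
      (isClosed_iInter fun x => isClosed_le continuous_const ?_))
      (isClosed_eq (continuous_id.matrix_trace) continuous_const)
    exact Continuous.dotProduct continuous_const (continuous_id.matrix_mulVec continuous_const)
  · intro B hB
    simp only [Set.mem_pi, Set.mem_univ, forall_true_left, Set.mem_Icc]
    exact fun u v => abs_le.1 (IsSpectraplex.abs_apply_le_one hB u v)

variable (H : SimpleGraph V) [DecidableRel H.Adj]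

/-- The linear map `B ↦ (𝟙ᵀB𝟙, B|_E)` recording the objective and the constrained entries.
[cite: Knuth1994, §7 (proof of the Lemma)] -/
def thetaConstraintMap : Matrix V V ℝ →ₗ[ℝ] ℝ × (V × V → ℝ) where
  toFun B := (entrySum B, fun p => if H.Adj p.1 p.2 then B p.1 p.2 else 0)
  map_add' B C := by
    ext p
    · simp [entrySum, sum_add_distrib]
    · simp only [Prod.snd_add, Pi.add_apply]
      split_ifs <;> simp
  map_smul' c B := by
    ext p
    · simp [entrySum, mul_sum]
    · simp only [RingHom.id_apply, Prod.smul_snd, Pi.smul_apply]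
      split_ifs <;> simp

omit [DecidableEq V] in
/-- `thetaConstraintMap` is continuous. [folklore] -/
theorem continuous_thetaConstraintMap : Continuous (thetaConstraintMap H) := by
  refine Continuous.prodMk ?_ ?_
  · exact continuous_finsetSum _ fun u _ => continuous_finsetSum _ fun v _ =>
      continuous_id.matrix_elem u v
  · refine continuous_pi fun p => ?_
    by_cases hp : H.Adj p.1 p.2
    · simp only [if_pos hp]
      exact continuous_id.matrix_elem p.1 p.2
    · simp only [if_neg hp]
      exact continuous_const


/-- A continuous linear functional on `ℝ × (V × V → ℝ)` in coordinates:
`f(a, N) = a·f(1,0) + ∑ₚ N(p) f(0, eₚ)`. [folklore] -/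
theorem strongDual_apply_eq (f : StrongDual ℝ (ℝ × (V × V → ℝ))) (a : ℝ) (N : V × V → ℝ) :
    f (a, N) = a * f (1, 0) + ∑ p, N p * f (0, fun q => if p = q then 1 else 0) := by
  have h1 : ((a, N) : ℝ × (V × V → ℝ)) = (a, (0 : V × V → ℝ)) + (0, N) := by simp
  have h2 : ((a, (0 : V × V → ℝ)) : ℝ × (V × V → ℝ)) = a • ((1 : ℝ), (0 : V × V → ℝ)) := by simp
  rw [h1, map_add, h2, map_smul, smul_eq_mul]
  congr 1
  set φ : (V × V → ℝ) →ₗ[ℝ] ℝ :=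
    (f : ℝ × (V × V → ℝ) →L[ℝ] ℝ).toLinearMap.comp (LinearMap.inr ℝ ℝ (V × V → ℝ)) with hφ
  have h3 : f (0, N) = φ N := rfl
  rw [h3, LinearMap.pi_apply_eq_sum_univ φ N]
  rfl

omit [DecidableEq V] in
/-- Re-indexing a sum over the (symmetric) edge set against a symmetric matrix. [folklore] -/
theorem sum_adj_swap {B : Matrix V V ℝ} (hB : ∀ u v, B v u = B u v) (g : V × V → ℝ) :
    ∑ u, ∑ v, (if H.Adj u v then g (v, u) * B u v else 0) =
      ∑ u, ∑ v, (if H.Adj u v then g (u, v) * B u v else 0) := by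
  rw [Finset.sum_comm]
  refine sum_congr rfl fun u _ => sum_congr rfl fun v _ => ?_
  by_cases h : H.Adj u v
  · rw [if_pos h, if_pos h.symm, hB u v]
  · rw [if_neg h, if_neg fun h' => h h'.symm]

omit [DecidableRel H.Adj] in
/-- **Strong duality for the Lovász number** (Knuth 1994, §7, Lemma `ϑ₂ ≤ ϑ₃` — "the heart of the
proof that all `ϑ`s are equivalent" — with the separation Fact of §§8–9; Lovász 1979, Theorem 3):
for every `s > ϑ(H)` there is a feasible matrix `A` (symmetric, `A_{uv} = 1` for `u = v` or
`u ≁ v`) all of whose eigenvalues are at most `s`, i.e. `sI - A ⪰ 0`. Proof by separating the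
point `(s, 0)` from the compact convex set `{(𝟙ᵀB𝟙, B|_E) : B ⪰ 0, Tr B = 1}`.
[cite: Knuth1994, §7 (Lemma) and §§8–9 (Fact F1)] -/
theorem exists_dual_of_lovaszTheta_lt [Nonempty V] {s : ℝ} (hs : lovaszTheta H < s) :
    ∃ A : Matrix V V ℝ, IsThetaDualFeasible H A ∧ (s • (1 : Matrix V V ℝ) - A).PosSemidef := by
  classical
  set K : Set (Matrix V V ℝ) := {B | IsSpectraplex B} with hK
  set L := thetaConstraintMap H with hL
  -- the image of the spectraplex is convex and closed, and misses `(s, 0)`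
  have hKconv : Convex ℝ K := by
    intro B₁ hB₁ B₂ hB₂ a b ha hb hab
    have ha' : a = 1 - b := by linarith
    rw [ha']
    exact IsSpectraplex.convexComb hB₁ hB₂ hb (by linarith)
  have hK'conv : Convex ℝ (L '' K) := hKconv.linear_image L
  have hK'closed : IsClosed (L '' K) :=
    (isCompact_setOf_isSpectraplex.image (continuous_thetaConstraintMap H)).isClosed
  have hp : ((s, 0) : ℝ × (V × V → ℝ)) ∉ L '' K := by
    rintro ⟨B, hBK, hLB⟩
    rw [Prod.ext_iff] at hLB
    obtain ⟨h1, h2⟩ := hLB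
    have hfeas : IsThetaFeasible H B := ⟨hBK.posSemidef, hBK.trace_eq_one, fun u v huv => by
      have := congrFun h2 (u, v)
      simpa [hL, thetaConstraintMap, huv] using this⟩
    have hle : entrySum B ≤ lovaszTheta H := le_csSup (bddAbove_thetaValues H) ⟨B, hfeas, rfl⟩
    have h1' : entrySum B = s := h1
    linarith
  obtain ⟨f, u₀, hfK, hfp⟩ := geometric_hahn_banach_closed_point hK'conv hK'closed hp
  -- read the functional as a symmetric matrix `N = t₀ J + Ψ`, `Ψ` supported on the edges
  set t₀ : ℝ := f (1, 0) with ht₀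
  set Φ : V × V → ℝ := fun p => f (0, fun q => if p = q then 1 else 0) with hΦ
  set N : Matrix V V ℝ := fun u v =>
    t₀ + (if H.Adj u v then (Φ (u, v) + Φ (v, u)) / 2 else 0) with hN
  have hNsymm : ∀ u v, N v u = N u v := fun u v => by
    simp only [hN]
    by_cases h : H.Adj u v
    · rw [if_pos h, if_pos h.symm, add_comm (Φ (v, u))]
    · rw [if_neg h, if_neg fun h' => h h'.symm]
  have hpair : ∀ B : Matrix V V ℝ, (∀ u v, B v u = B u v) → f (L B) = ∑ u, ∑ v, N u v * B u v := by
    intro B hBs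
    have hLB : L B = (entrySum B, fun p => if H.Adj p.1 p.2 then B p.1 p.2 else 0) := rfl
    rw [hLB, strongDual_apply_eq, Fintype.sum_prod_type]
    have lhs2 : ∑ x, ∑ y, (if H.Adj (x, y).1 (x, y).2 then B (x, y).1 (x, y).2 else 0) *
          f (0, fun q => if (x, y) = q then 1 else 0) =
        ∑ u, ∑ v, (if H.Adj u v then Φ (u, v) * B u v else 0) := by
      refine sum_congr rfl fun u _ => sum_congr rfl fun v _ => ?_
      dsimp only
      by_cases h : H.Adj u v
      · rw [if_pos h, if_pos h, hΦ, mul_comm]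
      · rw [if_neg h, if_neg h, zero_mul]
    have key := sum_adj_swap H hBs (fun p => Φ p / 2)
    have s1 : ∑ u, ∑ v, N u v * B u v = ∑ u, ∑ v, (t₀ * B u v +
        ((if H.Adj u v then Φ (u, v) / 2 * B u v else 0) +
          (if H.Adj u v then Φ (v, u) / 2 * B u v else 0))) :=
      sum_congr rfl fun u _ => sum_congr rfl fun v _ => by
        simp only [hN]
        split_ifs <;> ring
    have s2 : ∑ u, ∑ v, (if H.Adj u v then Φ (u, v) * B u v else 0) =
        2 * ∑ u, ∑ v, (if H.Adj u v then Φ (u, v) / 2 * B u v else 0) := by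
      rw [mul_sum]
      refine sum_congr rfl fun u _ => ?_
      rw [mul_sum]
      refine sum_congr rfl fun v _ => ?_
      split_ifs <;> ring
    have s3 : ∑ u, ∑ v, t₀ * B u v = t₀ * entrySum B := by
      simp only [entrySum, mul_sum]
    simp only [sum_add_distrib] at s1
    rw [lhs2, s1, s3, key, s2]
    ring
  -- every `B` of the spectraplex pairs to less than `t₀ s`
  have hlt : ∀ B : Matrix V V ℝ, IsSpectraplex B → ∑ u, ∑ v, N u v * B u v < t₀ * s := by
    intro B hB
    have h1 := hfK (L B) ⟨B, hB, rfl⟩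
    rw [hpair B hB.apply_comm] at h1
    have h2 : f (s, 0) = t₀ * s := by
      rw [strongDual_apply_eq]; simp [ht₀, mul_comm]
    linarith
  -- testing `B = |V|⁻¹ I` gives `t₀ > 0`
  have ht₀pos : 0 < t₀ := by
    have h := hlt _ (isSpectraplex_smul_one (V := V))
    have hval : ∑ u, ∑ v, N u v * ((Fintype.card V : ℝ)⁻¹ • (1 : Matrix V V ℝ)) u v = t₀ := by
      have hn : (Fintype.card V : ℝ) ≠ 0 := by exact_mod_cast Fintype.card_ne_zero
      have hdiag : ∀ u, N u u = t₀ := fun u => by simp [hN]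
      calc ∑ u, ∑ v, N u v * ((Fintype.card V : ℝ)⁻¹ • (1 : Matrix V V ℝ)) u v
          = ∑ u : V, (Fintype.card V : ℝ)⁻¹ * t₀ := by
            refine sum_congr rfl fun u _ => ?_
            rw [Finset.sum_eq_single u]
            · simp [hdiag u, mul_comm]
            · intro v _ hvu; simp [Matrix.one_apply_ne (Ne.symm hvu)]
            · simp
        _ = t₀ := by
            rw [sum_const, card_univ, nsmul_eq_mul, ← mul_assoc, mul_inv_cancel₀ hn, one_mul]
    rw [hval] at h
    have h1 : 1 < s := lt_of_le_of_lt (one_le_lovaszTheta H) hs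
    nlinarith
  -- the dual solution
  refine ⟨t₀⁻¹ • N, ⟨?_, ?_⟩, ?_⟩
  · refine Matrix.IsHermitian.ext fun u v => ?_
    simp [hNsymm v u]
  · intro u v huv
    simp [hN, huv, ht₀pos.ne']
  · refine PosSemidef.of_dotProduct_mulVec_nonneg (Matrix.IsHermitian.ext fun u v => ?_) fun x => ?_
    · by_cases huv : u = v
      · subst huv; simp
      · simp [Matrix.one_apply_ne huv, Matrix.one_apply_ne (Ne.symm huv), hNsymm v u]
    · rw [star_trivial, sub_mulVec, dotProduct_sub, smul_mulVec, one_mulVec, dotProduct_smul,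
        smul_eq_mul, sub_nonneg, smul_mulVec, dotProduct_smul, smul_eq_mul,
        dotProduct_mulVec_eq_sum_mul]
      -- `t₀⁻¹ xᵀNx ≤ s xᵀx`
      by_cases hx : x ⬝ᵥ x = 0
      · have hx0 : x = 0 := dotProduct_self_eq_zero.1 hx
        subst hx0
        simp
      · have hxpos : 0 < x ⬝ᵥ x := lt_of_le_of_ne (dotProduct_self_star_nonneg x) (Ne.symm hx)
        -- the normalised rank-one matrix is in `K`
        set B : Matrix V V ℝ := (x ⬝ᵥ x)⁻¹ • vecMulVec x x with hB
        have hBK : IsSpectraplex B := by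
          have h := posSemidef_vecMulVec_self_star (R := ℝ) x
          rw [star_trivial] at h
          have htr : (vecMulVec x x).trace = x ⬝ᵥ x := trace_vecMulVec x x
          have hB' : B = (vecMulVec x x).trace⁻¹ • vecMulVec x x := by rw [htr]
          rw [hB']
          exact IsSpectraplex.of_posSemidef_div h (by rwa [htr])
        have h := hlt B hBK
        have hsum : ∑ u, ∑ v, N u v * B u v = (x ⬝ᵥ x)⁻¹ * ∑ u, ∑ v, N u v * (x u * x v) := by
          simp only [hB, Matrix.smul_apply, vecMulVec_apply, smul_eq_mul, mul_sum]
          exact sum_congr rfl fun u _ => sum_congr rfl fun v _ => by ring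
        rw [hsum] at h
        rw [inv_mul_le_iff₀ ht₀pos]
        have := (inv_mul_lt_iff₀ hxpos).1 h
        nlinarith

omit [DecidableRel H.Adj] in
/-- **`ϑ(H) = inf { s : some feasible A has sI - A ⪰ 0 }`** — the eigenvalue characterisation
`ϑ = ϑ₂ = min_A Λ(A)` (Knuth 1994, §6 (6.3); Lovász 1979, Theorem 3), as an infimum over the
certified eigenvalue bounds `s`. [cite: Knuth1994, §6 (6.3) and §7] -/
theorem lovaszTheta_eq_sInf_dual [Nonempty V] :
    lovaszTheta H = sInf {s : ℝ | ∃ A : Matrix V V ℝ,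
      IsThetaDualFeasible H A ∧ (s • (1 : Matrix V V ℝ) - A).PosSemidef} := by
  have hbdd : BddBelow {s : ℝ | ∃ A : Matrix V V ℝ,
      IsThetaDualFeasible H A ∧ (s • (1 : Matrix V V ℝ) - A).PosSemidef} :=
    ⟨1, fun s ⟨A, hA, hs⟩ => one_le_of_dual hA hs⟩
  refine le_antisymm ?_ ?_
  · refine le_csInf ⟨lovaszTheta H + 1, exists_dual_of_lovaszTheta_lt H (lt_add_one _)⟩ ?_
    rintro s ⟨A, hA, hs⟩
    exact lovaszTheta_le_of_dual hA hs (zero_le_one.trans (one_le_of_dual hA hs))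
  · refine le_of_forall_gt_imp_ge_of_dense fun s hs => ?_
    exact csInf_le hbdd (exists_dual_of_lovaszTheta_lt H hs)

/-! ### Attainment: `ϑ(H) = min Λ(A)` -/

omit [DecidableRel H.Adj] in
/-- **The dual infimum is attained** (Knuth 1994, §6 (6.3): `ϑ₂ = min Λ(A)` is a minimum; Lovász
1979, Theorem 3): there is a feasible matrix `A` with `ϑ(H)·I - A ⪰ 0`. Proof: feasible `Aₖ` with
`(ϑ + 1/(k+1))I - Aₖ ⪰ 0` have entries in `[-(ϑ+1), ϑ+1]` (`abs_apply_le_of_dual`); a subsequence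
converges (compactness of the box), and feasibility and `sI - A ⪰ 0` pass to the limit.
[cite: Knuth1994, §6 (6.3)] -/
theorem exists_dual_of_lovaszTheta_eq [Nonempty V] :
    ∃ A : Matrix V V ℝ, IsThetaDualFeasible H A ∧ (lovaszTheta H • (1 : Matrix V V ℝ) - A).PosSemidef := by
  haveI : FirstCountableTopology (Matrix V V ℝ) := inferInstanceAs (FirstCountableTopology (V → V → ℝ))
  set θ := lovaszTheta H with hθ
  have hθ1 : 1 ≤ θ := one_le_lovaszTheta H
  -- near-optimal dual solutions
  have hex : ∀ k : ℕ, ∃ A : Matrix V V ℝ,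
      IsThetaDualFeasible H A ∧ ((θ + 1 / ((k : ℝ) + 1)) • (1 : Matrix V V ℝ) - A).PosSemidef :=
    fun k => exists_dual_of_lovaszTheta_lt H (by rw [hθ]; exact lt_add_of_pos_right _ (by positivity))
  choose A hA using hex
  -- they live in a compact box
  set S : Set (Matrix V V ℝ) := Set.pi Set.univ fun _ : V => Set.pi Set.univ fun _ : V => Set.Icc (-(θ + 1)) (θ + 1)
    with hS
  have hScpt : IsCompact S := isCompact_univ_pi fun _ => isCompact_univ_pi fun _ => isCompact_Icc
  have hAS : ∀ k, A k ∈ S := by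
    intro k
    refine Set.mem_univ_pi.2 fun u => Set.mem_univ_pi.2 fun v => ?_
    rw [Set.mem_Icc]
    by_cases huv : u = v
    · subst huv; rw [(hA k).1.apply_self]; constructor <;> linarith
    · have h := abs_apply_le_of_dual (hA k).1 (hA k).2 huv
      have hk : 1 / ((k : ℝ) + 1) ≤ 1 := by
        rw [div_le_one (by positivity)]; linarith [(Nat.cast_nonneg k : (0 : ℝ) ≤ k)]
      rw [abs_le] at h
      constructor <;> linarith [h.1, h.2]
  obtain ⟨A', -, φ, hφ, hlim⟩ := hScpt.tendsto_subseq hAS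
  -- coordinates converge
  have hcoord : ∀ u v, Filter.Tendsto (fun k => A (φ k) u v) Filter.atTop (nhds (A' u v)) := fun u v =>
    ((continuous_id.matrix_elem u v).tendsto A').comp hlim
  -- the limit is dual feasible
  have hsymm : ∀ u v, A' v u = A' u v := fun u v =>
    tendsto_nhds_unique (hcoord v u) (by simpa only [(hA _).1.apply_comm v u] using hcoord u v)
  have hfeas : IsThetaDualFeasible H A' :=
    ⟨Matrix.IsHermitian.ext fun u v => by rw [star_trivial]; exact hsymm u v, fun u v huv =>
      tendsto_nhds_unique (hcoord u v) (by simpa only [(hA _).1.apply_eq_one huv] using tendsto_const_nhds)⟩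
  refine ⟨A', hfeas, PosSemidef.of_dotProduct_mulVec_nonneg ?_ fun x => ?_⟩
  · refine Matrix.IsHermitian.ext fun u v => ?_
    by_cases huv : u = v
    · subst huv; simp
    · simp [Matrix.one_apply_ne huv, Matrix.one_apply_ne (Ne.symm huv), hsymm v u]
  · -- the quadratic forms `xᵀ((θ + 1/(φk+1))I - A_{φk})x ≥ 0` converge to `xᵀ(θ I - A')x`
    have hquad : ∀ (s : ℝ) (M : Matrix V V ℝ),
        x ⬝ᵥ ((s • (1 : Matrix V V ℝ) - M) *ᵥ x) = s * (x ⬝ᵥ x) - x ⬝ᵥ (M *ᵥ x) := by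
      intro s M
      rw [sub_mulVec, dotProduct_sub, smul_mulVec, one_mulVec, dotProduct_smul, smul_eq_mul]
    have hs : Filter.Tendsto (fun k => θ + 1 / (((φ k : ℕ) : ℝ) + 1)) Filter.atTop (nhds θ) := by
      have h0 := (tendsto_one_div_add_atTop_nhds_zero_nat (𝕜 := ℝ)).comp hφ.tendsto_atTop
      simpa using h0.const_add θ
    have hM : Filter.Tendsto (fun k => x ⬝ᵥ (A (φ k) *ᵥ x)) Filter.atTop (nhds (x ⬝ᵥ (A' *ᵥ x))) :=
      ((Continuous.dotProduct continuous_const (continuous_id.matrix_mulVec continuous_const)).tendsto A').comp hlim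
    have hlimit : Filter.Tendsto (fun k => x ⬝ᵥ (((θ + 1 / (((φ k : ℕ) : ℝ) + 1)) • (1 : Matrix V V ℝ) - A (φ k)) *ᵥ x))
        Filter.atTop (nhds (x ⬝ᵥ ((θ • (1 : Matrix V V ℝ) - A') *ᵥ x))) := by
      simp only [hquad]
      exact (hs.mul_const _).sub hM
    rw [star_trivial]
    refine ge_of_tendsto' hlimit fun k => ?_
    have h := (hA (φ k)).2.dotProduct_mulVec_nonneg x
    rwa [star_trivial] at h

omit [DecidableRel H.Adj] in
/-- **`ϑ(H)` is the least certified eigenvalue bound**: `ϑ(H) = min {s | ∃ feasible A, sI - A ⪰ 0}`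
(a minimum, not only an infimum — Knuth 1994, (6.3); Lovász 1979, Theorem 3). [cite: Knuth1994, §6 (6.3)] -/
theorem isLeast_lovaszTheta_dual [Nonempty V] :
    IsLeast {s : ℝ | ∃ A : Matrix V V ℝ,
      IsThetaDualFeasible H A ∧ (s • (1 : Matrix V V ℝ) - A).PosSemidef} (lovaszTheta H) :=
  ⟨exists_dual_of_lovaszTheta_eq H, fun _ ⟨_, hA, hs⟩ =>
    lovaszTheta_le_of_dual hA hs (zero_le_one.trans (one_le_of_dual hA hs))⟩

omit [DecidableRel H.Adj] in
/-- **Lovász's eigenvalue formula** `ϑ(H) = min_A Λ(A)` over the feasible matrices, with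
`Λ = topEigenvalue` (Knuth 1994, §6 (6.2)–(6.3); Lovász 1979, Theorem 3): some feasible `A` has
`Λ(A) = ϑ(H)`, and `ϑ(H) ≤ Λ(A')` for every feasible `A'`. [cite: Lovasz1979, Theorem 3] -/
theorem lovaszTheta_eq_min_topEigenvalue [Nonempty V] :
    (∃ (A : Matrix V V ℝ) (hA : IsThetaDualFeasible H A), topEigenvalue hA.isHermitian = lovaszTheta H) ∧
    ∀ (A : Matrix V V ℝ) (hA : IsThetaDualFeasible H A), lovaszTheta H ≤ topEigenvalue hA.isHermitian := by
  -- `ϑ ≤ Λ(A')`: `Λ(A') I - A' ⪰ 0` by the Rayleigh bound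
  have hge : ∀ (A : Matrix V V ℝ) (hA : IsThetaDualFeasible H A), lovaszTheta H ≤ topEigenvalue hA.isHermitian := by
    intro A hA
    have hpsd : (topEigenvalue hA.isHermitian • (1 : Matrix V V ℝ) - A).PosSemidef := by
      refine PosSemidef.of_dotProduct_mulVec_nonneg ?_ fun x => ?_
      · refine Matrix.IsHermitian.ext fun u v => ?_
        by_cases huv : u = v
        · subst huv; simp
        · simp [Matrix.one_apply_ne huv, Matrix.one_apply_ne (Ne.symm huv), hA.apply_comm v u]
      · rw [star_trivial, sub_mulVec, dotProduct_sub, smul_mulVec, one_mulVec, dotProduct_smul, smul_eq_mul,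
          sub_nonneg]
        exact dotProduct_mulVec_le hA.isHermitian x
    exact lovaszTheta_le_of_dual hA hpsd (zero_le_one.trans (one_le_of_dual hA hpsd))
  refine ⟨?_, hge⟩
  obtain ⟨A, hA, hpsd⟩ := exists_dual_of_lovaszTheta_eq H
  refine ⟨A, hA, le_antisymm ?_ (hge A hA)⟩
  -- `Λ(A) ≤ ϑ`: evaluate `ϑ I - A ⪰ 0` at a top eigenvector
  obtain ⟨i₀, hi₀⟩ := exists_eigenvalues_eq_topEigenvalue hA.isHermitian
  set w := (hA.isHermitian.eigenvectorBasis i₀).ofLp with hw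
  have hAw : A *ᵥ w = topEigenvalue hA.isHermitian • w := by
    rw [hw, hA.isHermitian.mulVec_eigenvectorBasis i₀, hi₀]
  have hww : w ⬝ᵥ w = 1 := by
    have := eigenvectorBasis_dotProduct hA.isHermitian i₀ i₀; rwa [if_pos rfl] at this
  have h := hpsd.dotProduct_mulVec_nonneg w
  rw [star_trivial, sub_mulVec, dotProduct_sub, smul_mulVec, one_mulVec, dotProduct_smul, hAw,
    dotProduct_smul, hww, smul_eq_mul, smul_eq_mul, mul_one, mul_one, sub_nonneg] at h
  exact h

end Literature.Combinatorics.SimpleGraph
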